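import Summits.RiemannHypothesis.RiemannHypothesis.Theorems.SignConeSignConeOscillatorySignedMajorantLemmas

/-!
# The signed far-field majorant with a near-origin deficit term
(route `SignCone`, item stmt-RiemannHypothesis-16302 `SignConeOscillatory`; HELPER file, `--supports`)

Bombieri's form of `W_ar = weilPolarTerm + weilArchTerm` (landed `SignConeFarField.stub_bombieriReal`):
`Re W_ar(F) = ∫₀^∞ h − (log 4π + γ)·A`, `A = Re F(0)`, `s(x) = Re F(x) + Re F(−x)`,
`h(x) = s(x)(e^{-x/2} + e^{x/2}) − (e^{x/2}s(x) − 2A)/(2 sinh x) = s(x)·w(x) + A/sinh x`.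
The far-field bookkeeping of `SignConeFarField.farFieldMajorant` (pieces `(0,t₁]`, `[t₁,t₂]`, `[t₂, log 2]`,
`[log 2, ∞)`, `t₁ = 4 log(15/14)`, `t₂ = 2 log(7/6)`) proves `Re W_ar(F) ≥ −A` with a MARGIN, and drops two
signed quantities which this file keeps:

* in the far field `x ≥ log 2` the sign hypothesis `s ≥ 0` is replaced by `s ≥ −2D` everywhere and `s ≥ 0`
  off ONE excursion `[α, α + ℓ]`; on the excursion `h ≥ A/sinh x − 2D(e^{x/2} + e^{-x/2})`
  (`regionFour_signed`), costing `8D(sinh((α+ℓ)/2) − sinh(α/2))` (LOSS);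
* near the origin, on `(ℓ, t₁]`, a DEFICIT hypothesis `s(x) ≤ 2(A − D)` improves the constant minorant
  `(97/28)A` to `(97/28)(A − D) + D/sinh x` (`regionOne_deficit`: `h` is affine in `A` with slope `1/sinh x`),
  gaining `D(∫_ℓ^{t₁} dx/sinh x − (97/28)(t₁ − ℓ))` (GAIN), `∫_ℓ^{t₁} dx/sinh x = log(12209/89041) − log tanh(ℓ/2)`.

Result (`signedFarFieldMajorant`): for a Weil test `F` with `|Re F| ≤ A`, `0 ≤ D ≤ A`, `log 2 ≤ α`,
`0 < ℓ ≤ t₁` and the three sign hypotheses above,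

  `Re W_ar(F) ≥ −A + (19/100)·A + D·Φ(α, ℓ)`,
  `Φ(α, ℓ) = log(12209/89041) − (log(e^ℓ − 1) − log(e^ℓ + 1)) − (97/28)(t₁ − ℓ) − 8(sinh((α+ℓ)/2) − sinh(α/2))`,

with the certified margin `19/100` (`farField_numerics_margin`; true margin `0.1956`). Positive-definiteness is
not used here; the deficit hypothesis is supplied by the lever of `SignConeSignConeOscillatoryLever` in
`SignConeSignConeOscillatoryShortExcursion`.
-/

noncomputable section

-- `Summit.RiemannHypothesis.RiemannHypothesis.…` repeats a namespace component by design (D-0017 layout).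
set_option linter.dupNamespace false

open scoped BigOperators ComplexConjugate
open Complex MeasureTheory Set Filter

namespace Summit.RiemannHypothesis.RiemannHypothesis.Theorems.SignCone

open Literature.NumberTheory.LFunctions
open Summit.RiemannHypothesis.RiemannHypothesis.Theorems.SignConeFarField

/-! ## Splitting `∫_{(0,∞)} h` into eight pieces -/

/-- Splitting `∫_{(a,∞)} = ∫_{(a,b]} + ∫_{(b,∞)}` for `h` integrable on `(0, ∞)`, `0 ≤ a ≤ b`. [folklore] -/
private theorem integral_Ioi_split' {h : ℝ → ℝ} {a b : ℝ} (ha : 0 ≤ a) (hab : a ≤ b)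
    (hint : IntegrableOn h (Ioi 0)) :
    ∫ x in Ioi a, h x = (∫ x in Ioc a b, h x) + ∫ x in Ioi b, h x := by
  rw [← Ioc_union_Ioi_eq_Ioi hab, setIntegral_union (Ioc_disjoint_Ioi le_rfl) measurableSet_Ioi
    (hint.mono_set (Ioc_subset_Ioi_self.trans (Ioi_subset_Ioi ha)))
    (hint.mono_set (Ioi_subset_Ioi (ha.trans hab)))]

/-- A constant minorant `c ≤ h` on `(a, b]` gives `c·(b − a) ≤ ∫_{(a,b]} h`. [folklore] -/
private theorem const_piece' {h : ℝ → ℝ} {a b c : ℝ} (ha : 0 ≤ a) (hab : a ≤ b)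
    (hint : IntegrableOn h (Ioi 0)) (hle : ∀ x, a < x → x ≤ b → c ≤ h x) :
    c * (b - a) ≤ ∫ x in Ioc a b, h x := by
  have hI : IntegrableOn h (Ioc a b) :=
    hint.mono_set (Ioc_subset_Ioi_self.trans (Ioi_subset_Ioi ha))
  have h1 : ∫ _ in Ioc a b, c = c * (b - a) := by
    rw [setIntegral_const, Real.volume_real_Ioc_of_le hab, smul_eq_mul, mul_comm]
  rw [← h1]
  exact setIntegral_mono_on (integrableOn_const (by rw [Real.volume_Ioc]; exact ENNReal.ofReal_ne_top))
    hI measurableSet_Ioc (fun x hx => hle x hx.1 hx.2)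

/-- A continuous minorant `φ ≤ h` on `(a, b]` (`φ` continuous on `[a, b]`) gives `∫_a^b φ ≤ ∫_{(a,b]} h`. [folklore] -/
private theorem cont_piece' {h φ : ℝ → ℝ} {a b : ℝ} (ha : 0 ≤ a) (hab : a ≤ b)
    (hint : IntegrableOn h (Ioi 0)) (hφ : ContinuousOn φ (Icc a b))
    (hle : ∀ x, a < x → x ≤ b → φ x ≤ h x) :
    (∫ x in a..b, φ x) ≤ ∫ x in Ioc a b, h x := by
  have hI : IntegrableOn h (Ioc a b) :=
    hint.mono_set (Ioc_subset_Ioi_self.trans (Ioi_subset_Ioi ha))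
  have hφI : IntegrableOn φ (Ioc a b) :=
    (hφ.integrableOn_Icc (μ := volume)).mono_set Ioc_subset_Icc_self
  rw [intervalIntegral.integral_of_le hab]
  exact setIntegral_mono_on hφI hI measurableSet_Ioc (fun x hx => hle x hx.1 hx.2)

/-- `1/sinh` is continuous on `[a, b]` for `a > 0`. [folklore] -/
private theorem continuousOn_one_div_sinh {a b : ℝ} (ha : 0 < a) :
    ContinuousOn (fun x => 1 / Real.sinh x) (Icc a b) :=
  ContinuousOn.div₀ continuousOn_const Real.continuous_sinh.continuousOn
    fun _ hx => (Real.sinh_pos_iff.2 (ha.trans_le hx.1)).ne'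

/-- `1/sinh` is interval integrable on `[a, b]` for `0 < a ≤ b`. [folklore] -/
private theorem intervalIntegrable_one_div_sinh {a b : ℝ} (ha : 0 < a) (hab : a ≤ b) :
    IntervalIntegrable (fun x => 1 / Real.sinh x) volume a b := by
  refine ContinuousOn.intervalIntegrable ?_
  rw [uIcc_of_le hab]
  exact continuousOn_one_div_sinh ha

/-- **The signed split.** For `A ≥ 0`, real `D`, `h` integrable on `(0, ∞)`, `0 < ℓ ≤ t₁`, `log 2 ≤ α`, and the pointwise
minorants of this file's regions (constant `97/28·A` on `(0, ℓ]`, `(A − D)·97/28 + D/sinh` on `(ℓ, t₁]`, `2.79 A` on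
`[t₁, t₂]`, `A·φ₃` on `[t₂, ∞)`, `A/sinh − 2D(e^{x/2} + e^{-x/2})` on `[log 2, ∞)` and `A/sinh` on
`[log 2, ∞) ∖ (α, α + ℓ]`):
`A·(97/28·t₁ + 2.79(t₂ − t₁) + ∫_{t₂}^{log 2} φ₃ + ∫_{log 2}^{log 2001} dx/sinh x)`
`+ D·(∫_ℓ^{t₁} dx/sinh x − 97/28 (t₁ − ℓ) − 8(sinh((α+ℓ)/2) − sinh(α/2))) ≤ ∫_{(0,∞)} h`. [folklore] -/
theorem signed_split (A D : ℝ) (h : ℝ → ℝ) (α ℓ : ℝ) (hA : 0 ≤ A)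
    (hint : IntegrableOn h (Set.Ioi 0)) (hℓ : 0 < ℓ) (hℓt : ℓ ≤ 4 * Real.log (15 / 14)) (hα : Real.log 2 ≤ α)
    (h1a : ∀ x, 0 < x → x ≤ ℓ → A * (97 / 28) ≤ h x)
    (h1b : ∀ x, ℓ < x → x ≤ 4 * Real.log (15 / 14) → (A - D) * (97 / 28) + D / Real.sinh x ≤ h x)
    (h2 : ∀ x, 4 * Real.log (15 / 14) ≤ x → x ≤ 2 * Real.log (7 / 6) → A * (279 / 100) ≤ h x)
    (h3 : ∀ x, 2 * Real.log (7 / 6) ≤ x →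
      A * (Real.exp (x / 2) / (Real.exp (x / 2) - 1) - 36 / 85 * (Real.exp (x / 2) * (Real.exp (x / 2) - 1)) -
        2 * Real.exp (x / 2) - 2 * Real.exp (-(x / 2))) ≤ h x)
    (h4 : ∀ x, Real.log 2 ≤ x → A / Real.sinh x - 2 * D * (Real.exp (x / 2) + Real.exp (-(x / 2))) ≤ h x)
    (h4' : ∀ x, Real.log 2 ≤ x → (x ≤ α ∨ α + ℓ < x) → A / Real.sinh x ≤ h x) :
    A * (97 / 28 * (4 * Real.log (15 / 14)) + 279 / 100 * (2 * Real.log (7 / 6) - 4 * Real.log (15 / 14)) +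
        (∫ x in (2 * Real.log (7 / 6))..Real.log 2,
          (Real.exp (x / 2) / (Real.exp (x / 2) - 1) - 36 / 85 * (Real.exp (x / 2) * (Real.exp (x / 2) - 1)) -
            2 * Real.exp (x / 2) - 2 * Real.exp (-(x / 2)))) +
        ∫ x in Real.log 2..Real.log 2001, 1 / Real.sinh x) +
      D * ((∫ x in ℓ..(4 * Real.log (15 / 14)), 1 / Real.sinh x) - 97 / 28 * (4 * Real.log (15 / 14) - ℓ) -
        8 * (Real.sinh ((α + ℓ) / 2) - Real.sinh (α / 2))) ≤
      ∫ x in Set.Ioi (0 : ℝ), h x := by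
  -- abbreviations and order of the split points
  set t₁ : ℝ := 4 * Real.log (15 / 14) with ht₁_def
  set t₂ : ℝ := 2 * Real.log (7 / 6) with ht₂_def
  set L : ℝ := Real.log 2 with hL_def
  set Y : ℝ := max (α + ℓ) (Real.log 2001) with hY_def
  have ht₁ : 0 < t₁ := by
    have := Real.log_pos (by norm_num : (1 : ℝ) < 15 / 14)
    rw [ht₁_def]; linarith
  have e₁ : t₁ = Real.log ((15 / 14) ^ 4) := by rw [ht₁_def, Real.log_pow]; norm_num
  have e₂ : t₂ = Real.log ((7 / 6) ^ 2) := by rw [ht₂_def, Real.log_pow]; norm_num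
  have h₁₂ : t₁ ≤ t₂ := by rw [e₁, e₂]; exact Real.log_le_log (by norm_num) (by norm_num)
  have h₂L : t₂ ≤ L := by rw [e₂, hL_def]; exact Real.log_le_log (by norm_num) (by norm_num)
  have hL : 0 < L := Real.log_pos (by norm_num)
  have ht₂ : 0 < t₂ := ht₁.trans_le h₁₂
  have hα0 : 0 < α := hL.trans_le hα
  have hαℓ : α ≤ α + ℓ := by linarith
  have hY1 : α + ℓ ≤ Y := le_max_left _ _
  have hY2 : Real.log 2001 ≤ Y := le_max_right _ _
  have hLT : L ≤ Real.log 2001 := Real.log_le_log (by norm_num) (by norm_num)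
  have hαℓ0 : 0 < α + ℓ := by linarith
  -- the eight pieces
  rw [integral_Ioi_split' le_rfl hℓ.le hint, integral_Ioi_split' hℓ.le hℓt hint,
    integral_Ioi_split' ht₁.le h₁₂ hint, integral_Ioi_split' ht₂.le h₂L hint,
    integral_Ioi_split' hL.le hα hint, integral_Ioi_split' hα0.le hαℓ hint,
    integral_Ioi_split' hαℓ0.le hY1 hint]
  have p1 := const_piece' le_rfl hℓ.le hint h1a
  have p2 : (∫ x in ℓ..t₁, ((A - D) * (97 / 28) + D * (1 / Real.sinh x))) ≤ ∫ x in Ioc ℓ t₁, h x := by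
    refine cont_piece' hℓ.le hℓt hint ?_ (fun x hx hx' => ?_)
    · exact continuousOn_const.add (continuousOn_const.mul (continuousOn_one_div_sinh hℓ))
    · rw [mul_one_div]
      exact h1b x hx hx'
  have p2e : (∫ x in ℓ..t₁, ((A - D) * (97 / 28) + D * (1 / Real.sinh x))) =
      (A - D) * (97 / 28) * (t₁ - ℓ) + D * ∫ x in ℓ..t₁, 1 / Real.sinh x := by
    rw [intervalIntegral.integral_add intervalIntegrable_const
        ((intervalIntegrable_one_div_sinh hℓ hℓt).const_mul D),
      intervalIntegral.integral_const, intervalIntegral.integral_const_mul, smul_eq_mul, mul_comm]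
  have p3 := const_piece' ht₁.le h₁₂ hint (fun x hx hx' => h2 x hx.le hx')
  have p4 : (∫ x in t₂..L,
      A * (Real.exp (x / 2) / (Real.exp (x / 2) - 1) - 36 / 85 * (Real.exp (x / 2) * (Real.exp (x / 2) - 1)) -
        2 * Real.exp (x / 2) - 2 * Real.exp (-(x / 2)))) ≤ ∫ x in Ioc t₂ L, h x := by
    refine cont_piece' ht₂.le h₂L hint ?_ (fun x hx _ => h3 x hx.le)
    intro x hx
    have hx0 : Real.exp (x / 2) - 1 ≠ 0 := by
      have : 1 < Real.exp (x / 2) := Real.one_lt_exp_iff.2 (by linarith [hx.1])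
      exact (sub_pos.2 this).ne'
    refine ContinuousAt.continuousWithinAt ?_
    fun_prop (disch := exact hx0)
  have p4e : (∫ x in t₂..L,
      A * (Real.exp (x / 2) / (Real.exp (x / 2) - 1) - 36 / 85 * (Real.exp (x / 2) * (Real.exp (x / 2) - 1)) -
        2 * Real.exp (x / 2) - 2 * Real.exp (-(x / 2)))) =
      A * ∫ x in t₂..L, (Real.exp (x / 2) / (Real.exp (x / 2) - 1) - 36 / 85 * (Real.exp (x / 2) * (Real.exp (x / 2) - 1)) -
        2 * Real.exp (x / 2) - 2 * Real.exp (-(x / 2))) := intervalIntegral.integral_const_mul _ _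
  have p5 : (∫ x in L..α, A * (1 / Real.sinh x)) ≤ ∫ x in Ioc L α, h x := by
    refine cont_piece' hL.le hα hint (continuousOn_const.mul (continuousOn_one_div_sinh hL)) (fun x hx hx' => ?_)
    rw [mul_one_div]
    exact h4' x hx.le (Or.inl hx')
  have p6 : (∫ x in α..(α + ℓ), (A * (1 / Real.sinh x) - 2 * D * (Real.exp (x / 2) + Real.exp (-(x / 2))))) ≤
      ∫ x in Ioc α (α + ℓ), h x := by
    refine cont_piece' hα0.le hαℓ hint ?_ (fun x hx _ => ?_)
    · exact (continuousOn_const.mul (continuousOn_one_div_sinh hα0)).sub (Continuous.continuousOn (by fun_prop))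
    · rw [mul_one_div]
      exact h4 x (hα.trans hx.le)
  have p6e : (∫ x in α..(α + ℓ), (A * (1 / Real.sinh x) - 2 * D * (Real.exp (x / 2) + Real.exp (-(x / 2))))) =
      A * (∫ x in α..(α + ℓ), 1 / Real.sinh x) - 2 * D * (4 * Real.sinh ((α + ℓ) / 2) - 4 * Real.sinh (α / 2)) := by
    rw [intervalIntegral.integral_sub ((intervalIntegrable_one_div_sinh hα0 hαℓ).const_mul A)
        ((Continuous.intervalIntegrable (by fun_prop) _ _).const_mul (2 * D)),
      intervalIntegral.integral_const_mul, intervalIntegral.integral_const_mul, integral_exp_half_add_exp_neg_half]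
  have p7 : (∫ x in (α + ℓ)..Y, A * (1 / Real.sinh x)) ≤ ∫ x in Ioc (α + ℓ) Y, h x := by
    refine cont_piece' hαℓ0.le hY1 hint (continuousOn_const.mul (continuousOn_one_div_sinh hαℓ0))
      (fun x hx _ => ?_)
    rw [mul_one_div]
    exact h4' x (by linarith [hx]) (Or.inr hx)
  have p8 : 0 ≤ ∫ x in Ioi Y, h x := by
    refine setIntegral_nonneg measurableSet_Ioi (fun x hx => ?_)
    have hx : Y < x := hx
    have hs : 0 < Real.sinh x := Real.sinh_pos_iff.2 (by linarith)
    exact (div_nonneg hA hs.le).trans (h4' x (by linarith) (Or.inr (by linarith)))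
  -- the far-field `1/sinh` pieces add up to `∫_{log 2}^{Y} ≥ ∫_{log 2}^{log 2001}`
  have i5 : (∫ x in L..α, A * (1 / Real.sinh x)) = A * ∫ x in L..α, 1 / Real.sinh x :=
    intervalIntegral.integral_const_mul _ _
  have i7 : (∫ x in (α + ℓ)..Y, A * (1 / Real.sinh x)) = A * ∫ x in (α + ℓ)..Y, 1 / Real.sinh x :=
    intervalIntegral.integral_const_mul _ _
  have iadd : (∫ x in L..α, 1 / Real.sinh x) + (∫ x in α..(α + ℓ), 1 / Real.sinh x) +
      (∫ x in (α + ℓ)..Y, 1 / Real.sinh x) = ∫ x in L..Y, 1 / Real.sinh x := by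
    rw [intervalIntegral.integral_add_adjacent_intervals (intervalIntegrable_one_div_sinh hL hα)
        (intervalIntegrable_one_div_sinh hα0 hαℓ),
      intervalIntegral.integral_add_adjacent_intervals (intervalIntegrable_one_div_sinh hL (hα.trans hαℓ))
        (intervalIntegrable_one_div_sinh hαℓ0 hY1)]
  have imono : (∫ x in L..Real.log 2001, 1 / Real.sinh x) ≤ ∫ x in L..Y, 1 / Real.sinh x := by
    rw [← intervalIntegral.integral_add_adjacent_intervals (intervalIntegrable_one_div_sinh hL hLT)
        (intervalIntegrable_one_div_sinh (hL.trans_le hLT) hY2)]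
    have : 0 ≤ ∫ x in Real.log 2001..Y, 1 / Real.sinh x := by
      refine intervalIntegral.integral_nonneg hY2 (fun x hx => ?_)
      have hs : 0 < Real.sinh x := Real.sinh_pos_iff.2 ((hL.trans_le hLT).trans_le hx.1)
      positivity
    linarith
  have hfar : A * (∫ x in L..Real.log 2001, 1 / Real.sinh x) ≤
      (∫ x in L..α, A * (1 / Real.sinh x)) + A * (∫ x in α..(α + ℓ), 1 / Real.sinh x) +
        ∫ x in (α + ℓ)..Y, A * (1 / Real.sinh x) := by
    rw [i5, i7, ← mul_add, ← mul_add, iadd]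
    exact mul_le_mul_of_nonneg_left imono hA
  rw [p2e] at p2
  rw [p4e] at p4
  rw [p6e] at p6
  nlinarith [p1, p2, p3, p4, p5, p6, p7, p8, hfar]

/-! ## The signed far-field majorant -/

/-- **The signed far-field majorant with deficit.** Let `F` be a Weil test with `|Re F(t)| ≤ A := Re F(0)` for all `t`,
and let `0 ≤ D ≤ A`, `log 2 ≤ α`, `0 < ℓ ≤ t₁ = 4 log(15/14)`. Suppose, with `s(x) = Re F(x) + Re F(−x)`:
(negativity bounded) `s(x) ≥ −2D` for `x ≥ log 2`; (confined) `s(x) ≥ 0` for `x ≥ log 2` off `(α, α + ℓ]`;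
(deficit) `s(x) ≤ 2(A − D)` for `ℓ < x ≤ t₁`. Then
`−A + (19/100)A + D·Φ(α,ℓ) ≤ Re (weilPolarTerm F + weilArchTerm F)` with
`Φ(α,ℓ) = log(12209/89041) − (log(e^ℓ − 1) − log(e^ℓ + 1)) − (97/28)(t₁ − ℓ) − 8(sinh((α+ℓ)/2) − sinh(α/2))`. -/
theorem signedFarFieldMajorant (F : ℝ → ℂ) (hF : IsWeilTest F) {D α ℓ : ℝ}
    (hbd : ∀ t : ℝ, |(F t).re| ≤ (F 0).re) (hD0 : 0 ≤ D) (hDA : D ≤ (F 0).re)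
    (hα : Real.log 2 ≤ α) (hℓ : 0 < ℓ) (hℓt : ℓ ≤ 4 * Real.log (15 / 14))
    (hneg : ∀ x : ℝ, Real.log 2 ≤ x → -(2 * D) ≤ (F x).re + (F (-x)).re)
    (hout : ∀ x : ℝ, Real.log 2 ≤ x → (x ≤ α ∨ α + ℓ < x) → 0 ≤ (F x).re + (F (-x)).re)
    (hdef : ∀ x : ℝ, ℓ < x → x ≤ 4 * Real.log (15 / 14) → (F x).re + (F (-x)).re ≤ 2 * ((F 0).re - D)) :
    -(F 0).re + (19 / 100 * (F 0).re +
        D * (Real.log (12209 / 89041) - (Real.log (Real.exp ℓ - 1) - Real.log (Real.exp ℓ + 1)) -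
          97 / 28 * (4 * Real.log (15 / 14) - ℓ) - 8 * (Real.sinh ((α + ℓ) / 2) - Real.sinh (α / 2)))) ≤
      (weilPolarTerm F + weilArchTerm F).re := by
  obtain ⟨hint, hform⟩ := stub_bombieriReal F hF
  set A : ℝ := (F 0).re with hA_def
  set h : ℝ → ℝ := fun x : ℝ => ((F x).re + (F (-x)).re) * (Real.exp (-(x / 2)) + Real.exp (x / 2)) -
    (Real.exp (x / 2) * ((F x).re + (F (-x)).re) - 2 * A) / (2 * Real.sinh x) with hh_def
  have hA : 0 ≤ A := le_trans (abs_nonneg _) (hbd 0)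
  have hs_le : ∀ x : ℝ, (F x).re + (F (-x)).re ≤ 2 * A := fun x => by
    have h1 := (abs_le.1 (hbd x)).2
    have h2 := (abs_le.1 (hbd (-x))).2
    linarith
  have hs_ge : ∀ x : ℝ, -(2 * A) ≤ (F x).re + (F (-x)).re := fun x => by
    have h1 := (abs_le.1 (hbd x)).1
    have h2 := (abs_le.1 (hbd (-x))).1
    linarith
  have hs_abs : ∀ x : ℝ, |(F x).re + (F (-x)).re| ≤ 2 * A := fun x => abs_le.2 ⟨hs_ge x, hs_le x⟩
  have ht₁ : 0 < 4 * Real.log (15 / 14) := by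
    have := Real.log_pos (by norm_num : (1 : ℝ) < 15 / 14)
    linarith
  have h1a : ∀ x, 0 < x → x ≤ ℓ → A * (97 / 28) ≤ h x :=
    fun x hx hx1 => stub_regionOneTwo.1 A _ x hA (hs_le x) hx (hx1.trans hℓt)
  have h1b : ∀ x, ℓ < x → x ≤ 4 * Real.log (15 / 14) → (A - D) * (97 / 28) + D / Real.sinh x ≤ h x :=
    fun x hx hx1 => regionOne_deficit A D _ x (by linarith) (hdef x hx hx1) (hℓ.trans hx) hx1
  have h2 : ∀ x, 4 * Real.log (15 / 14) ≤ x → x ≤ 2 * Real.log (7 / 6) → A * (279 / 100) ≤ h x :=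
    fun x hx hx1 => stub_regionOneTwo.2 A _ x hA (hs_abs x) hx hx1
  have h3 : ∀ x, 2 * Real.log (7 / 6) ≤ x →
      A * (Real.exp (x / 2) / (Real.exp (x / 2) - 1) - 36 / 85 * (Real.exp (x / 2) * (Real.exp (x / 2) - 1)) -
        2 * Real.exp (x / 2) - 2 * Real.exp (-(x / 2))) ≤ h x :=
    fun x hx => stub_regionThreeFour.1 A _ x hA (hs_ge x) hx
  have h4 : ∀ x, Real.log 2 ≤ x → A / Real.sinh x - 2 * D * (Real.exp (x / 2) + Real.exp (-(x / 2))) ≤ h x :=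
    fun x hx => regionFour_signed A D _ x hA hD0 (hneg x hx) hx
  have h4' : ∀ x, Real.log 2 ≤ x → (x ≤ α ∨ α + ℓ < x) → A / Real.sinh x ≤ h x :=
    fun x hx hx' => stub_regionThreeFour.2 A _ x hA (hout x hx hx') hx
  have hsplit := signed_split A D h α ℓ hA hint hℓ hℓt hα h1a h1b h2 h3 h4 h4'
  have hI3 := stub_intThree
  have hI4 := stub_intFour
  have hnum := farField_numerics_margin
  have hgain : (∫ x in ℓ..(4 * Real.log (15 / 14)), 1 / Real.sinh x) =
      Real.log (12209 / 89041) - (Real.log (Real.exp ℓ - 1) - Real.log (Real.exp ℓ + 1)) := by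
    rw [integral_one_div_sinh hℓ hℓt, primitive_at_t₁]
  rw [hgain] at hsplit
  have key : (Real.log (4 * Real.pi) + Real.eulerMascheroniConstant - 1 + 19 / 100) * A +
      D * (Real.log (12209 / 89041) - (Real.log (Real.exp ℓ - 1) - Real.log (Real.exp ℓ + 1)) -
          97 / 28 * (4 * Real.log (15 / 14) - ℓ) - 8 * (Real.sinh ((α + ℓ) / 2) - Real.sinh (α / 2))) ≤
      ∫ x in Set.Ioi (0 : ℝ), h x := by
    refine le_trans ?_ hsplit
    have : (Real.log (4 * Real.pi) + Real.eulerMascheroniConstant - 1 + 19 / 100) * A ≤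
        A * (97 / 28 * (4 * Real.log (15 / 14)) + 279 / 100 * (2 * Real.log (7 / 6) - 4 * Real.log (15 / 14)) +
          (∫ x in (2 * Real.log (7 / 6))..Real.log 2,
            (Real.exp (x / 2) / (Real.exp (x / 2) - 1) - 36 / 85 * (Real.exp (x / 2) * (Real.exp (x / 2) - 1)) -
              2 * Real.exp (x / 2) - 2 * Real.exp (-(x / 2)))) +
          ∫ x in Real.log 2..Real.log 2001, 1 / Real.sinh x) := by
      rw [mul_comm]
      exact mul_le_mul_of_nonneg_left (by linarith) hA
    linarith
  rw [hform]
  linarith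

/-- **Registered form of the signed far-field majorant** (sub-goal `stub_signedFarFieldMajorant` of item stmt-RiemannHypothesis-16302). -/
theorem stub_signedFarFieldMajorant : ∀ (F : ℝ → ℂ), IsWeilTest F → ∀ D α ℓ : ℝ, (∀ t : ℝ, |(F t).re| ≤ (F 0).re) → 0 ≤ D → D ≤ (F 0).re → Real.log 2 ≤ α → 0 < ℓ → ℓ ≤ 4 * Real.log (15 / 14) → (∀ x : ℝ, Real.log 2 ≤ x → -(2 * D) ≤ (F x).re + (F (-x)).re) → (∀ x : ℝ, Real.log 2 ≤ x → (x ≤ α ∨ α + ℓ < x) → 0 ≤ (F x).re + (F (-x)).re) → (∀ x : ℝ, ℓ < x → x ≤ 4 * Real.log (15 / 14) → (F x).re + (F (-x)).re ≤ 2 * ((F 0).re - D)) → -(F 0).re + (19 / 100 * (F 0).re + D * (Real.log (12209 / 89041) - (Real.log (Real.exp ℓ - 1) - Real.log (Real.exp ℓ + 1)) - 97 / 28 * (4 * Real.log (15 / 14) - ℓ) - 8 * (Real.sinh ((α + ℓ) / 2) - Real.sinh (α / 2)))) ≤ (weilPolarTerm F + weilArchTerm F).re :=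
  fun F hF _ _ _ hbd hD0 hDA hα hℓ hℓt hneg hout hdef => signedFarFieldMajorant F hF hbd hD0 hDA hα hℓ hℓt hneg hout hdef

end Summit.RiemannHypothesis.RiemannHypothesis.Theorems.SignCone

end
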